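import Summits.Ventures.CertifiedArithmetic.LowPrec.SRTwoSumExactAux
import HarnessLib

/-!
# 2Sum under SR is an error-free transformation when `maxScaled ≤ 4^p` (file XLIII b)

HONEST FRAMING: certified error envelopes and provably optimal rounding/accumulation schemes for
low-precision formats under stated cost models; every table by two implementations; no hardware or
vendor claims.

**`twoSumE_exact_of_small`: if the largest finite magnitude of the format is at most `4^(m+1)`
quanta then, for ALL data `a, b` (saturation included), 2Sum executed under saturating stochastic
rounding returns `s + t = a + b` with probability one.**  Named instances: E2M1 (`maxScaled = 12 ≤
16`, agreeing with the kernel evaluation of all 225 pairs in file XXXIX b) and E2M3 (`60 ≤ 256`,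
agreeing with the two-implementation certificate `certs/sr/gen7/eft/`, 3969 pairs).  The converse
(every format with `maxScaled > 4^(m+1)` has a pair with `P < 1`) is file XLIV.

Proof (file XLIII a supplies the tools).  By the criterion it suffices that on every branch
`(s, a')` the quantities `a − a'`, `b − (s − a')`, `a + b − s` are values.  With `x = s − b`,
`err = a + b − s`, `ρ = x − a'` one has `a − a' = err + ρ` and `b − (s − a') = −ρ`.
* `err ∈ F` (file XLIII a, `err_mem_of_small`): beyond the hull it is the saturation error (always
  a value); inside, `|err|` is below the gap, which is `≤ 2^p` quanta below `4^p` quanta, and every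
  multiple of the quantum of magnitude `≤ 2^p` quanta is a value.
* `a + b > maxRat` (then `s = maxRat`, `x = maxRat − b ∈ [0, a)`): if `x ∉ F` then `b < maxRat/2`
  (Sterbenz), so `maxRat/2 ≤ a' ≤ a ≤ maxRat` and `a − a' ∈ F` by Sterbenz; `|ρ| <` gap.
* `x > maxRat` (operation 2 saturates, `a' = maxRat`): then `b < 0 < a + b`, `s ≤ a` and
  `a > maxRat/2`, so `a − maxRat ∈ F` by Sterbenz, and `b − (s − maxRat)` is a multiple of the
  ulp of the smaller of `|b|, |s|` of magnitude below it (the EFT criterion).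
* `|x| ≤ maxRat`, `x ∉ F`: `|err|, |ρ| ≤ 2^p − 1` quanta; if `a − a'` is an even number of quanta
  it is a value (`≤ 2^(p+1)` quanta); if odd, either `a` is odd — then `|a| < 2^p` quanta, `x` is an
  odd number in `(2^p, 2^(p+1))` quanta whose two even neighbours are values, so `|ρ| = 1` quantum
  and `|a − a'| ≤ 2^p` quanta — or `a'` is odd, `|a'| < 2^p` quanta, impossible next to `|x| > 2^p`.
Signs are normalised to `0 ≤ a` by the symmetry `(a, b) ↦ (−a, −b)` of the value set.

[cite: BoldoGraillatMuller2017, Thm 4.1 / Lemma 4.2 (deterministic faithful 2Sum, no overflow);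
BoldoMelquiond2017, Thm 5.1 (Sterbenz), Lemma 5.2 (EFT criterion); the criterion
`maxScaled ≤ 4^p` and the probability-one statement: new]
-/

namespace Summit.Ventures.CertifiedArithmetic.LowPrec.SR

open Literature.ComputerArithmetic.ConnollyHighamMary2021
open Literature.ComputerArithmetic.FloatingPoint
open Finset MiniFloat

section Formats

variable {φ : Format}

/-- `0 ∈ F` (also in file `SRRungR3Exact`, not imported here). -/
private theorem zero_mem (φ : Format) : (0 : ℚ) ∈ valueSet φ := by
  have h := toRat_mem_valueSet (MiniFloat.zero φ); rwa [toRat_zero] at h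

/-! ### The three memberships, case by case (`0 ≤ a`) -/

/-- Case `x = s − b ∈ F`: then `a' = x`, `a − a' = a + b − s`, `b − (s − a') = 0`. -/
theorem triple_of_mem (hM : φ.maxScaled ≤ 4 ^ (φ.manBits + 1)) (a b : MiniFloat φ) {s a' : ℚ}
    (hs : Faithful (valueSet φ) (a.toRat + b.toRat) s)
    (ha' : Faithful (valueSet φ) (s - b.toRat) a') (hx : s - b.toRat ∈ valueSet φ) :
    a.toRat - a' ∈ valueSet φ ∧ b.toRat - (s - a') ∈ valueSet φ ∧
      a.toRat + b.toRat - s ∈ valueSet φ := by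
  have he := err_mem_of_small hM a b hs
  rw [ha'.eq_of_mem hx]
  refine ⟨?_, ?_, he⟩
  · convert he using 1; ring
  · rw [show b.toRat - (s - (s - b.toRat)) = 0 by ring]; exact zero_mem φ

/-- Case `a + b > maxRat` (operation 1 saturates, `s = maxRat`). -/
theorem triple_of_sat (hM : φ.maxScaled ≤ 4 ^ (φ.manBits + 1))
    (hbig : 2 ^ (φ.manBits + 1) ≤ φ.maxScaled) (a b : MiniFloat φ) {s a' : ℚ}
    (hs : Faithful (valueSet φ) (a.toRat + b.toRat) s)
    (ha' : Faithful (valueSet φ) (s - b.toRat) a') (hsat : φ.maxRat < a.toRat + b.toRat) :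
    a.toRat - a' ∈ valueSet φ ∧ b.toRat - (s - a') ∈ valueSet φ ∧
      a.toRat + b.toRat - s ∈ valueSet φ := by
  by_cases hx : s - b.toRat ∈ valueSet φ
  · exact triple_of_mem hM a b hs ha' hx
  have hq := φ.quantum_pos
  have he := err_mem_of_small hM a b hs
  have hsM : s = φ.maxRat := hs.eq_maxRat hsat
  have hA := abs_le.mp (abs_toRat_le_maxRat a)
  have hB := abs_le.mp (abs_toRat_le_maxRat b)
  -- `maxRat / 2 ∈ F`, and `b < maxRat / 2` (else `maxRat − b ∈ F` by Sterbenz)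
  have hhalf : φ.maxRat / 2 ∈ valueSet φ :=
    (half_maxRat_mem_or_lt φ).resolve_right (not_lt.mpr hbig)
  have hb2 : b.toRat < φ.maxRat / 2 := by
    by_contra hcon; push Not at hcon
    obtain ⟨d, hd⟩ := sterbenz (top φ) b (by rw [toRat_top]; linarith) (by rw [toRat_top]; linarith)
    exact hx (mem_valueSet.mpr ⟨d, by rw [hd, toRat_top, hsM]⟩)
  -- `maxRat/2 ≤ a' ≤ a ≤ maxRat`: Sterbenz for `a − a'`
  have h1 : φ.maxRat / 2 ≤ a' := ha'.ge_of_mem hhalf (by rw [hsM]; linarith)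
  have h2 : a' ≤ a.toRat := ha'.le_of_mem (toRat_mem_valueSet a) (by rw [hsM]; linarith)
  obtain ⟨z, rfl⟩ := mem_valueSet.mp ha'.mem
  obtain ⟨d, hd⟩ := sterbenz a z (by linarith) (by linarith)
  refine ⟨mem_valueSet.mpr ⟨d, hd⟩, ?_, he⟩
  -- `b − (s − a') = a' − x`, `|a' − x| < gap(x) ≤ 2^p · quantum`
  have hxlt : |s - b.toRat| < φ.maxRat := by
    rw [hsM, abs_lt]; constructor <;> linarith
  have hgap := ha'.abs_err_lt_gap ((valueSet_inHull_iff φ _).mpr hxlt.le) hx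
  have hg := gap_le_pow_of_small hM hxlt
  have hrepr : b.toRat - (s - z.toRat)
      = ((b.toInt - φ.maxScaled + z.toInt : ℤ) : ℚ) * φ.quantum := by
    rw [hsM]; simp only [toRat_eq_toInt_mul]; unfold Format.maxRat; push_cast; ring
  rw [hrepr]
  refine intMul_mem_of_abs_le_pow hbig ?_
  rw [← hrepr, show b.toRat - (s - z.toRat) = -(s - b.toRat - z.toRat) by ring, abs_neg]
  push_cast; linarith

/-- Case `s − b > maxRat` (operation 2 saturates upward, `a' = maxRat`). -/
theorem triple_of_xsat (hM : φ.maxScaled ≤ 4 ^ (φ.manBits + 1)) (a b : MiniFloat φ)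
    {s a' : ℚ} (hs : Faithful (valueSet φ) (a.toRat + b.toRat) s)
    (ha' : Faithful (valueSet φ) (s - b.toRat) a') (hxs : φ.maxRat < s - b.toRat) :
    a.toRat - a' ∈ valueSet φ ∧ b.toRat - (s - a') ∈ valueSet φ ∧
      a.toRat + b.toRat - s ∈ valueSet φ := by
  have hq := φ.quantum_pos
  have he := err_mem_of_small hM a b hs
  have haM : a' = φ.maxRat := ha'.eq_maxRat hxs
  obtain ⟨w, rfl⟩ := mem_valueSet.mp hs.mem
  have hA := abs_le.mp (abs_toRat_le_maxRat a)
  have hB := abs_le.mp (abs_toRat_le_maxRat b)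
  have hW := abs_le.mp (abs_toRat_le_maxRat w)
  -- order facts: `b < 0 < a + b`, `0 ≤ s ≤ a`, `maxRat < 2a`
  have hb0 : b.toRat < 0 := by linarith [hW.2]
  have hsa : w.toRat ≤ a.toRat := hs.le_of_mem (toRat_mem_valueSet a) (by linarith)
  have hc0 : 0 < a.toRat + b.toRat := by
    by_contra hcon; push Not at hcon
    have := hs.le_of_mem (zero_mem φ) hcon
    linarith [hB.1]
  have hs0 : 0 ≤ w.toRat := hs.ge_of_mem (zero_mem φ) hc0.le
  -- `a − a' = −(maxRat − a)`, Sterbenz on `(maxRat, a)`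
  obtain ⟨d, hd⟩ := sterbenz (top φ) a (by rw [toRat_top]; linarith) (by rw [toRat_top]; linarith)
  refine ⟨?_, ?_, he⟩
  · have h := neg_mem_valueSet (mem_valueSet.mpr ⟨d, hd⟩)
    rw [toRat_top] at h; rw [haM]; convert h using 1; ring
  -- `b − (s − maxRat)`: EFT criterion, donor the smaller of `|b|, |s|`
  rw [haM]
  have hrepr : b.toRat - (w.toRat - φ.maxRat)
      = ((b.toInt - w.toInt + φ.maxScaled : ℤ) : ℚ) * φ.quantum := by
    simp only [toRat_eq_toInt_mul]; unfold Format.maxRat; push_cast; ring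
  rw [hrepr]
  have hMb := Int.natCast_dvd_natCast.mpr (pow_ulpExp_dvd_maxScaled b)
  have hMw := Int.natCast_dvd_natCast.mpr (pow_ulpExp_dvd_maxScaled w)
  have hbI : b.toInt = -(b.scaledMag : ℤ) := by
    have h := toInt_eq_scaledMag_of_nonneg (v := b.flipSign) (by rw [toRat_flipSign]; linarith)
    have h2 : b.flipSign.toInt = -b.toInt := by
      have h3 : b.flipSign.toRat = ((-b.toInt : ℤ) : ℚ) * φ.quantum := by
        rw [toRat_flipSign, toRat_eq_toInt_mul]; push_cast; ring
      exact toInt_eq_of_toRat_eq h3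
    have h4 : b.flipSign.scaledMag = b.scaledMag := by
      rw [← natAbs_toInt, ← natAbs_toInt, h2, Int.natAbs_neg]
    rw [h2, h4] at h; omega
  have hwI := toInt_eq_scaledMag_of_nonneg hs0
  -- the magnitude `x − maxRat = s − b − maxRat` as an integer
  have hT : ((b.toInt - w.toInt + φ.maxScaled : ℤ) : ℚ) * φ.quantum
      = -((w.toRat - b.toRat) - φ.maxRat) := by rw [← hrepr]; ring
  rcases le_total b.scaledMag w.scaledMag with hbw | hwb
  · refine intMul_mem_valueSet (representable_natAbs_of_dvd_le b ?_ ?_)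
    · exact dvd_add (dvd_sub (pow_ulpExp_dvd_toInt le_rfl) (pow_ulpExp_dvd_toInt hbw)) hMb
    · -- `x − maxRat ≤ |b|` since `s ≤ maxRat`
      have h1 : |((b.toInt - w.toInt + φ.maxScaled : ℤ) : ℚ) * φ.quantum|
          ≤ (b.scaledMag : ℚ) * φ.quantum := by
        rw [hT, abs_neg, abs_of_pos (by linarith), ← abs_toRat, abs_of_neg hb0]; linarith [hW.2]
      exact natAbs_le_of_abs_mul_le h1
  · refine intMul_mem_valueSet (representable_natAbs_of_dvd_le w ?_ ?_)
    · exact dvd_add (dvd_sub (pow_ulpExp_dvd_toInt hwb) (pow_ulpExp_dvd_toInt le_rfl)) hMw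
    · -- `x − maxRat ≤ s` since `−b ≤ maxRat`
      have h1 : |((b.toInt - w.toInt + φ.maxScaled : ℤ) : ℚ) * φ.quantum|
          ≤ (w.scaledMag : ℚ) * φ.quantum := by
        rw [hT, abs_neg, abs_of_pos (by linarith), ← abs_toRat, abs_of_nonneg hs0]
        linarith [hB.1]
      exact natAbs_le_of_abs_mul_le h1

/-- Case `|a + b| ≤ maxRat`, `|s − b| ≤ maxRat`, `s − b ∉ F` (no saturation anywhere). -/
theorem triple_of_inHull (hM : φ.maxScaled ≤ 4 ^ (φ.manBits + 1))
    (hbig : 2 ^ (φ.manBits + 1) ≤ φ.maxScaled) (a b : MiniFloat φ) {s a' : ℚ}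
    (hs : Faithful (valueSet φ) (a.toRat + b.toRat) s)
    (ha' : Faithful (valueSet φ) (s - b.toRat) a') (hc : |a.toRat + b.toRat| ≤ φ.maxRat)
    (hxh : |s - b.toRat| ≤ φ.maxRat) (hx : s - b.toRat ∉ valueSet φ) :
    a.toRat - a' ∈ valueSet φ ∧ b.toRat - (s - a') ∈ valueSet φ ∧
      a.toRat + b.toRat - s ∈ valueSet φ := by
  have hq := φ.quantum_pos
  have he := err_mem_of_small hM a b hs
  obtain ⟨w, rfl⟩ := mem_valueSet.mp hs.mem
  obtain ⟨z, rfl⟩ := mem_valueSet.mp ha'.mem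
  -- `a + b ∉ F` (else `s = a + b`, `x = a ∈ F`)
  have hcF : a.toRat + b.toRat ∉ valueSet φ := fun h => hx (by
    rw [hs.eq_of_mem h, show a.toRat + b.toRat - b.toRat = a.toRat by ring]
    exact toRat_mem_valueSet a)
  have hclt : |a.toRat + b.toRat| < φ.maxRat := by
    refine lt_of_le_of_ne hc fun h => hcF ?_
    rcases (abs_eq ((abs_nonneg _).trans_eq h)).mp h with h' | h'
    · rw [h']; exact maxRat_mem_valueSet φ
    · rw [h']; exact neg_maxRat_mem_valueSet φ
  have hxlt : |w.toRat - b.toRat| < φ.maxRat := by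
    refine lt_of_le_of_ne hxh fun h => hx ?_
    rcases (abs_eq ((abs_nonneg _).trans_eq h)).mp h with h' | h'
    · rw [h']; exact maxRat_mem_valueSet φ
    · rw [h']; exact neg_maxRat_mem_valueSet φ
  -- integers: E = err, X = x, R = ρ, D = a − a' (in quanta)
  have hP : ((2 ^ (φ.manBits + 1) : ℕ) : ℚ) = 2 ^ (φ.manBits + 1) := by push_cast; ring
  have hE : a.toRat + b.toRat - w.toRat = ((a.toInt + b.toInt - w.toInt : ℤ) : ℚ) * φ.quantum := by
    simp only [toRat_eq_toInt_mul]; push_cast; ring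
  have hX : w.toRat - b.toRat = ((w.toInt - b.toInt : ℤ) : ℚ) * φ.quantum := by
    simp only [toRat_eq_toInt_mul]; push_cast; ring
  have hR : w.toRat - b.toRat - z.toRat = ((w.toInt - b.toInt - z.toInt : ℤ) : ℚ) * φ.quantum := by
    simp only [toRat_eq_toInt_mul]; push_cast; ring
  have hD : a.toRat - z.toRat = ((a.toInt - z.toInt : ℤ) : ℚ) * φ.quantum := by
    simp only [toRat_eq_toInt_mul]; push_cast; ring
  have hgE := hs.abs_err_lt_gap ((valueSet_inHull_iff φ _).mpr hclt.le) hcF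
  have hgX := ha'.abs_err_lt_gap ((valueSet_inHull_iff φ _).mpr hxlt.le) hx
  have h4E := gap_le_pow_of_small hM hclt
  have h4X := gap_le_pow_of_small hM hxlt
  have hEb : (a.toInt + b.toInt - w.toInt).natAbs < 2 ^ (φ.manBits + 1) :=
    natAbs_lt_of_abs_mul_lt (by rw [← hE, hP]; linarith)
  have hRb : (w.toInt - b.toInt - z.toInt).natAbs < 2 ^ (φ.manBits + 1) :=
    natAbs_lt_of_abs_mul_lt (by rw [← hR, hP]; linarith)
  have hXM : (w.toInt - b.toInt).natAbs < φ.maxScaled :=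
    natAbs_lt_of_abs_mul_lt (by rw [← hX]; unfold Format.maxRat at hxlt; exact_mod_cast hxlt)
  have hDM : (a.toInt - z.toInt).natAbs ≤ φ.maxScaled :=
    natAbs_le_maxScaled_of_abs_le (hD ▸ (valueSet_inHull_iff φ _).mp (twoSum_op4_inHull a b hs ha'))
  -- `b − (s − a') = −ρ`
  refine ⟨?_, ?_, he⟩
  swap
  · rw [show b.toRat - (w.toRat - z.toRat) = ((-(w.toInt - b.toInt - z.toInt) : ℤ) : ℚ) * φ.quantum
      by rw [Int.cast_neg, neg_mul, ← hR]; ring]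
    exact intMul_mem_of_natAbs_le_pow (by rw [Int.natAbs_neg]; exact hRb.le)
      (by rw [Int.natAbs_neg]; exact hRb.le.trans hbig)
  -- `a − a' = E + R`
  rw [hD]
  have hsum : a.toInt - z.toInt
      = (a.toInt + b.toInt - w.toInt) + (w.toInt - b.toInt - z.toInt) := by ring
  rcases Int.even_or_odd (a.toInt - z.toInt) with hev | hodd
  · exact intMul_mem_of_even (even_iff_two_dvd.mp hev) (by rw [pow_succ]; omega) hDM
  -- odd: `x ∉ F` forces `|X| > 2^p` and `X` odd
  have hXbig : 2 ^ (φ.manBits + 1) < (w.toInt - b.toInt).natAbs := by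
    by_contra hcon; push Not at hcon
    exact hx (hX ▸ intMul_mem_of_natAbs_le_pow hcon hXM.le)
  rcases Int.odd_sub.mp hodd |>.symm |> fun h => Int.even_or_odd a.toInt with haev | haodd
  · -- `a` even ⟹ `a'` odd ⟹ `|a'| < 2^p` quanta: impossible next to `|x| > 2^p` quanta
    have hzodd : Odd z.toInt := by
      rcases Int.even_or_odd z.toInt with hz | hz
      · exact absurd (Int.even_sub.mpr (iff_of_true haev hz)) (Int.not_even_iff_odd.mpr hodd)
      · exact hz
    have hzlt := natAbs_lt_pow_of_odd z hzodd
    have hpow : ((2 ^ (φ.manBits + 1) : ℕ) : ℤ) * φ.quantum ∈ valueSet φ :=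
      intMul_mem_of_natAbs_le_pow (by simp) (by simpa using hbig)
    have hzabs : |z.toRat| < (2 ^ (φ.manBits + 1) : ℕ) * φ.quantum := by
      rw [abs_toRat, ← natAbs_toInt]
      exact mul_lt_mul_of_pos_right (by exact_mod_cast hzlt) hq
    exfalso
    rcases le_or_gt 0 (w.toInt - b.toInt) with hX0 | hX0
    · -- `x > 2^p · q`: `a' ≥ 2^p · q`
      have hxge : ((2 ^ (φ.manBits + 1) : ℕ) : ℤ) * φ.quantum ≤ w.toRat - b.toRat := by
        rw [hX]; refine mul_le_mul_of_nonneg_right ?_ hq.le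
        have : ((2 ^ (φ.manBits + 1) : ℕ) : ℤ) ≤ w.toInt - b.toInt := by omega
        exact_mod_cast this
      have h1 := ha'.ge_of_mem hpow hxge
      have h2 := (abs_lt.mp hzabs).2
      push_cast at h1 h2; linarith
    · have hpow' := neg_mem_valueSet hpow
      have hxle : w.toRat - b.toRat ≤ -(((2 ^ (φ.manBits + 1) : ℕ) : ℤ) * φ.quantum) := by
        rw [hX, ← neg_mul]; refine mul_le_mul_of_nonneg_right ?_ hq.le
        have : w.toInt - b.toInt ≤ -((2 ^ (φ.manBits + 1) : ℕ) : ℤ) := by omega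
        exact_mod_cast this
      have h1 := ha'.le_of_mem hpow' hxle
      have h2 := (abs_lt.mp hzabs).1
      push_cast at h1 h2; linarith
  · -- `a` odd ⟹ `|a| < 2^p` quanta ⟹ `X` odd in `(2^p, 2^(p+1))`, neighbours even ⟹ `|R| = 1`
    have halt := natAbs_lt_pow_of_odd a haodd
    have hXle : (w.toInt - b.toInt).natAbs + 2 ≤ 2 ^ (φ.manBits + 2) := by
      have : w.toInt - b.toInt = a.toInt - (a.toInt + b.toInt - w.toInt) := by ring
      rw [this, pow_succ]; omega
    have hXodd : ¬ (2 : ℤ) ∣ (w.toInt - b.toInt) := fun h2 =>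
      hx (hX ▸ intMul_mem_of_even h2 (by omega) hXM.le)
    have hl : (((w.toInt - b.toInt - 1 : ℤ)) : ℚ) * φ.quantum ∈ valueSet φ :=
      intMul_mem_of_even (by omega) (by omega) (by omega)
    have hr : (((w.toInt - b.toInt + 1 : ℤ)) : ℚ) * φ.quantum ∈ valueSet φ :=
      intMul_mem_of_even (by omega) (by omega) (by omega)
    have hcases := ha'.eq_or_eq_of_neighbours hx hl hr
      (by rw [hX]; exact mul_le_mul_of_nonneg_right (by push_cast; linarith) hq.le)
      (by rw [hX]; exact mul_le_mul_of_nonneg_right (by push_cast; linarith) hq.le)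
      (fun y hy h1 h2 => not_mem_strictly_between hy h1 (by rw [hX] at h2; simpa using h2))
      (fun y hy h1 h2 => not_mem_strictly_between hy (by rw [hX] at h1; exact h1) h2)
    have hz1 : z.toInt = w.toInt - b.toInt - 1 ∨ z.toInt = w.toInt - b.toInt + 1 := by
      rcases hcases with h | h
      · exact Or.inl (toInt_eq_of_toRat_eq h)
      · exact Or.inr (toInt_eq_of_toRat_eq h)
    refine intMul_mem_of_natAbs_le_pow ?_ hDM
    rcases hz1 with h | h <;> omega

/-- The three memberships on every branch, `0 ≤ a`. -/
theorem triple_of_small_nonneg (hM : φ.maxScaled ≤ 4 ^ (φ.manBits + 1)) (a b : MiniFloat φ)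
    (ha : 0 ≤ a.toRat) {s a' : ℚ} (hs : Faithful (valueSet φ) (a.toRat + b.toRat) s)
    (ha' : Faithful (valueSet φ) (s - b.toRat) a') :
    a.toRat - a' ∈ valueSet φ ∧ b.toRat - (s - a') ∈ valueSet φ ∧
      a.toRat + b.toRat - s ∈ valueSet φ := by
  by_cases hx : s - b.toRat ∈ valueSet φ
  · exact triple_of_mem hM a b hs ha' hx
  rcases Nat.lt_or_ge φ.maxScaled (2 ^ (φ.manBits + 1)) with hbot | hbig
  · -- bottom regime: every in-range multiple of the quantum is a value, so `x ∈ F`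
    exfalso; apply hx
    have hA := abs_le.mp (abs_toRat_le_maxRat a)
    have hB := abs_le.mp (abs_toRat_le_maxRat b)
    rcases lt_or_ge φ.maxRat (a.toRat + b.toRat) with hsat | hcle
    · -- `s = maxRat`, `x = maxRat − b ∈ [0, maxRat)`
      rw [hs.eq_maxRat hsat]
      have hX : φ.maxRat - b.toRat = ((φ.maxScaled - b.toInt : ℤ) : ℚ) * φ.quantum := by
        simp only [toRat_eq_toInt_mul]; unfold Format.maxRat; push_cast; ring
      rw [hX]; refine intMul_mem_of_bottom hbot (natAbs_le_maxScaled_of_abs_le ?_)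
      rw [← hX, abs_le]; constructor <;> linarith
    · -- `a + b` is a value, `s = a + b`, `x = a`
      have hC : a.toRat + b.toRat = ((a.toInt + b.toInt : ℤ) : ℚ) * φ.quantum := by
        simp only [toRat_eq_toInt_mul]; push_cast; ring
      have hcmem : a.toRat + b.toRat ∈ valueSet φ := by
        rw [hC]; refine intMul_mem_of_bottom hbot (natAbs_le_maxScaled_of_abs_le ?_)
        rw [← hC, abs_le]; constructor <;> linarith
      rw [hs.eq_of_mem hcmem, show a.toRat + b.toRat - b.toRat = a.toRat by ring]
      exact toRat_mem_valueSet a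
  rcases lt_or_ge φ.maxRat (a.toRat + b.toRat) with hsat | hcle
  · exact triple_of_sat hM hbig a b hs ha' hsat
  have hB := abs_le.mp (abs_toRat_le_maxRat b)
  have hc : |a.toRat + b.toRat| ≤ φ.maxRat := abs_le.mpr ⟨by linarith, hcle⟩
  rcases lt_or_ge φ.maxRat (s - b.toRat) with hxs | hxle
  · exact triple_of_xsat hM a b hs ha' hxs
  have hxge : b.toRat ≤ s := hs.ge_of_mem (toRat_mem_valueSet b) (by linarith)
  have hxh : |s - b.toRat| ≤ φ.maxRat := abs_le.mpr ⟨by linarith, hxle⟩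
  exact triple_of_inHull hM hbig a b hs ha' hc hxh hx

/-- The three memberships on every branch, all data (sign symmetry `(a, b) ↦ (−a, −b)`). -/
theorem triple_of_small (hM : φ.maxScaled ≤ 4 ^ (φ.manBits + 1)) (a b : MiniFloat φ)
    {s a' : ℚ} (hs : Faithful (valueSet φ) (a.toRat + b.toRat) s)
    (ha' : Faithful (valueSet φ) (s - b.toRat) a') :
    a.toRat - a' ∈ valueSet φ ∧ b.toRat - (s - a') ∈ valueSet φ ∧
      a.toRat + b.toRat - s ∈ valueSet φ := by
  rcases le_or_gt 0 a.toRat with ha | ha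
  · exact triple_of_small_nonneg hM a b ha hs ha'
  · have hsym := fun y (hy : y ∈ valueSet φ) => neg_mem_valueSet hy
    have hs' : Faithful (valueSet φ) (a.flipSign.toRat + b.flipSign.toRat) (-s) := by
      rw [toRat_flipSign, toRat_flipSign, ← neg_add]; exact hs.neg hsym
    have ha'' : Faithful (valueSet φ) (-s - b.flipSign.toRat) (-a') := by
      rw [toRat_flipSign, show -s - -b.toRat = -(s - b.toRat) by ring]; exact ha'.neg hsym
    obtain ⟨h1, h2, h3⟩ := triple_of_small_nonneg hM a.flipSign b.flipSign
      (by rw [toRat_flipSign]; linarith) hs' ha''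
    rw [toRat_flipSign] at h1 h2 h3; rw [toRat_flipSign] at h3
    refine ⟨?_, ?_, ?_⟩
    · convert neg_mem_valueSet h1 using 1; ring
    · convert neg_mem_valueSet h2 using 1; ring
    · convert neg_mem_valueSet h3 using 1; ring

/-! ### The theorem -/

/-- **2SUM UNDER SR IS AN ERROR-FREE TRANSFORMATION WHEN `maxScaled ≤ 4^(m+1)`**: for every such
format and ALL data `a, b` (saturation of operations 1 and 2 included),
`P(s + t = a + b) = 1`. -/
theorem twoSumE_exact_of_small (hM : φ.maxScaled ≤ 4 ^ (φ.manBits + 1)) (a b : MiniFloat φ) :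
    twoSumE (valueSet φ) a.toRat b.toRat
      (fun s t => if s + t = a.toRat + b.toRat then 1 else 0) = 1 :=
  twoSumE_exact_of_mem a b fun _ _ hs ha' => triple_of_small hM a b hs ha'

/-- E2M1: `maxScaled = 12 ≤ 16` — 2Sum under SR is surely exact on FP4 (the structural proof of
the kernel fact `twoSumE_exact_e2m1` of file XXXIX b). -/
theorem twoSumE_exact_E2M1 (a b : MiniFloat Format.E2M1) :
    twoSumE (valueSet Format.E2M1) a.toRat b.toRat
      (fun s t => if s + t = a.toRat + b.toRat then 1 else 0) = 1 :=
  twoSumE_exact_of_small (by decide) a b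

/-- **E2M3: `maxScaled = 60 ≤ 256` — 2Sum under SR is surely exact on all `63 × 63` pairs of the
OCP FP6 format E2M3** (previously known only as a two-implementation certificate,
`certs/sr/gen7/eft/`). -/
theorem twoSumE_exact_E2M3 (a b : MiniFloat Format.E2M3) :
    twoSumE (valueSet Format.E2M3) a.toRat b.toRat
      (fun s t => if s + t = a.toRat + b.toRat then 1 else 0) = 1 :=
  twoSumE_exact_of_small (by decide) a b

end Formats

end Summit.Ventures.CertifiedArithmetic.LowPrec.SR
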